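import Mathlib.Analysis.SpecialFunctions.Pow.Real
import Literature.Barriers.MatrixMultiplication.NilpotentGroupBarrierSawin
import Literature.Barriers.MatrixMultiplication.NilpotentGroupBarrierProofs
import Summits.MatrixMultiplication.MatrixMultiplication.Theorems.SoloInformedGroupDoorExclusions
import HarnessLib

/-!
# A uniform slice-rank saving on the powers of the hosts — with an arbitrary constant — closes the group-theoretic door

Solo-informed seat, summit `MatrixMultiplication` (gen 62).  BCCGU 2017, Cor. 2.11 ("Key
corollary") is in the tree in the constant-free form `BCCGU2017_cor211`
(`slice-rank D_{G^N} ≤ |G|^{N(1-δ)}` for all `N ≥ 1` ⟹ CKSU (2.2) at `w = 2 + 2δ`).  Slice-rank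
bounds produced by a Chernoff / threshold count on graded coordinates carry a CONSTANT:
`slice-rank D_{G^N} ≤ c · |G|^{N(1-δ)}` (BCCGU Thm. 3.11: `c = 3`; the seat's Loewy-filtration bound
for products of `SL₂(p^{nᵢ})` in defining characteristic, `paper/sl2-defining-char-note.md`
Thm. C(p): `c_p = 1 + 2/t_lo(p) ∈ (3, 4.3]`).  This file removes the constant by the tensor-power
trick on MATCHINGS (`IsMulMatching.pow`, as in the tree's proof of Sawin's Thm. 1.5) and runs the
tree's BCCGNSU/BCCGU chain, ending at the seat's door theorem:

* `card_le_of_sliceRank_pow_le_const` — matchings in `((G^N)^3)^{N'}` are `≤ 3 (|G|^{(1-δ)3N})^{N'}`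
  from `slice-rank D_{G^M} ≤ c|G|^{M(1-δ)}` (any real `c`);
* `stpp_ineq_of_sliceRank_pow_le_const` — hence (2.2) at `w = 2 + 2δ` for every STPP family in `G`
  (`SimultaneousTPP.sum_rpow_le_of_matching_bound`, `sum_rpow_le_charDegreePowSum_of_sum_rpow_le`),
  and `tpp_certificate_of_sliceRank_pow_le_const` for a single TPP triple;
* `no_tppFamily_of_sliceRankSaving` — **a family of finite groups whose members' powers obey
  `slice-rank_{Kᵢ} D_{Gᵢ^M} ≤ c|Gᵢ|^{M(1-δ)}` with ONE pair `(c, δ)`, `δ > 0` (fields `Kᵢ` arbitrary,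
  varying) is not a Cohn–Umans Cor. 4.3 family** (`tppFamily_false_of_noCertificate`).

With the markdown Theorem C(p) of the note (for each prime `p`: every finite product
`G = ∏ SL₂(p^{nᵢ})` has `slice-rank_{𝔽_p} D_G ≤ c_p ∏ |SL₂(p^{nᵢ})|^{1-δ_p}`, and powers of products
are products) the last theorem is Corollary D(p): no `ω = 2` family of TPP constructions in products
of the groups `SL₂(pⁿ)`, `q = pⁿ` and the number of factors both free — the rank-one case of the
question of Blasiak–Cohn–Grochow–Pratt–Umans 2023, §5, for fixed `p`.  A direct factor `A` of
bounded relative size costs only `|A|` in the graded count (the tree's `GradedCoords.card_prod_trivial`),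
so products of `GL₂(2ⁿ) = SL₂(2ⁿ) × C_{2ⁿ-1}` are covered by the same hypothesis with
`δ' = δ · log|SL₂| / log|GL₂|`.
[cite: BlasiakChurchCohnGrochowUmans2017, Cor. 2.11, Thm. 2.8, Thm. 2.9, Prop. 2.10]
[cite: Sawin2018, Thm. 1.5 (proof: amplification)]
[cite: BlasiakCohnGrochowPrattUmans2023, §5]
[cite: CohnUmans2003, Cor. 4.3]
-/

set_option linter.dupNamespace false

noncomputable section

open scoped BigOperators

namespace Summit.MatrixMultiplication.MatrixMultiplication.Theorems

open Filter Topology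
open Literature.Computability.AlgebraicComplexity
open Literature.RepresentationTheory.FiniteGroups Literature.Combinatorics.Additive
open Literature.Barriers.MatrixMultiplication

/-! ## Matchings in `((G^N)^3)^{N'}` from a slice-rank bound with a constant -/

section Matchings

/-- **Prop. 2.10 + amplification**: if `slice-rank_K D_{G^M} ≤ c · |G|^{M(1-δ)}` for all `M ≥ 1`
(any real constant `c`), then every multiplicative matching in `((G^N)^3)^{N'}` has size
`≤ 3 ((|G|^{1-δ})^{3N})^{N'}`.  The matching is moved to `G^{3NN'}` (`piProdThreeHom`,
`piReindexHom`), its `k`-th power (`IsMulMatching.pow`) is bounded by the slice rank of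
`D_{G^{3NN'k}}` (`IsMulMatching.card_le_sliceRank`), and `k → ∞` removes `c`
(`le_of_pow_le_poly_mul_pow`).  [cite: BlasiakChurchCohnGrochowUmans2017, Prop. 2.10]
[cite: Sawin2018, Thm. 1.5 (proof)] -/
theorem card_le_of_sliceRank_pow_le_const {G : Type} [Group G] [Fintype G] [DecidableEq G]
    {K : Type} [Field K] {δ c : ℝ}
    (hsr : ∀ M : ℕ, 1 ≤ M →
      (sliceRank (mulGroupTensor K (Fin M → G)) : ℝ) ≤
        c * (Fintype.card G : ℝ) ^ ((M : ℝ) * (1 - δ)))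
    (N N' : ℕ) (ι' : Type) [Fintype ι']
    (s t u : ι' → (Fin N' → (Fin N → G) × (Fin N → G) × (Fin N → G)))
    (h : IsMulMatching s t u) :
    (Fintype.card ι' : ℝ) ≤ 3 * (((Fintype.card G : ℝ) ^ (1 - δ)) ^ (3 * N)) ^ N' := by
  classical
  have hGpos : (0 : ℝ) < Fintype.card G := by exact_mod_cast Fintype.card_pos
  have hY : 0 < (Fintype.card G : ℝ) ^ (1 - δ) := Real.rpow_pos_of_pos hGpos _
  rcases Nat.eq_zero_or_pos N with hN | hN
  · subst hN
    have h1 : Fintype.card ι' ≤ 1 := h.card_le_one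
    have h1' : (Fintype.card ι' : ℝ) ≤ 1 := by exact_mod_cast h1
    simp only [mul_zero, pow_zero, one_pow, mul_one]
    linarith
  rcases Nat.eq_zero_or_pos N' with hN' | hN'
  · subst hN'
    have h1 : Fintype.card ι' ≤ 1 := h.card_le_one
    have h1' : (Fintype.card ι' : ℝ) ≤ 1 := by exact_mod_cast h1
    simp only [pow_zero, mul_one]
    linarith
  -- transport the matching to `G^{Fin M}`, `M = |T| = N' (3N)`
  set T := Fin N' × ((Fin N ⊕ Fin N) ⊕ Fin N) with hT
  set φ := (piReindexHom (G := G) T).comp (piProdThreeHom N N') with hφ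
  have hφi : Function.Injective φ :=
    (piReindexHom_injective T).comp (piProdThreeHom_injective N N')
  have hM : IsMulMatching (φ ∘ s) (φ ∘ t) (φ ∘ u) := h.map φ hφi
  have hcardT : Fintype.card T = N' * (3 * N) := by
    simp only [hT, Fintype.card_prod, Fintype.card_sum, Fintype.card_fin]; ring
  have hTpos : 0 < Fintype.card T := by
    rw [hcardT]; exact Nat.pos_of_ne_zero (Nat.mul_ne_zero hN'.ne' (by omega))
  -- amplification: `|ι'|^k ≤ c · (Y^M)^k` for all `k ≥ 1`, hence `|ι'| ≤ Y^M`
  have hyM : 0 < ((Fintype.card G : ℝ) ^ (1 - δ)) ^ Fintype.card T := pow_pos hY _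
  have key : (Fintype.card ι' : ℝ) ≤ ((Fintype.card G : ℝ) ^ (1 - δ)) ^ Fintype.card T := by
    refine Literature.Computability.AlgebraicComplexity.Combinatorics.le_of_pow_le_poly_mul_pow
      (c := c) (d := 0) hyM fun k hk => ?_
    have h1 := ((hM.pow k).map (piReindexHom (G := G) (Fin k × Fin (Fintype.card T)))
      (piReindexHom_injective _)).card_le_sliceRank (K := K)
    have hkT : Fintype.card (Fin k × Fin (Fintype.card T)) = k * Fintype.card T := by
      rw [Fintype.card_prod, Fintype.card_fin, Fintype.card_fin]
    have hge : 1 ≤ Fintype.card (Fin k × Fin (Fintype.card T)) := by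
      rw [hkT]; exact Nat.one_le_iff_ne_zero.2 (Nat.mul_ne_zero (by omega) hTpos.ne')
    have h2 := hsr (Fintype.card (Fin k × Fin (Fintype.card T))) hge
    have h1' : ((Fintype.card ι' : ℝ)) ^ k ≤
        (sliceRank (mulGroupTensor K (Fin (Fintype.card (Fin k × Fin (Fintype.card T))) → G)) : ℝ) := by
      have hfun : Fintype.card (Fin k → ι') = Fintype.card ι' ^ k := by
        rw [Fintype.card_fun, Fintype.card_fin]
      have := h1
      rw [hfun] at this
      exact_mod_cast this
    have h3 : (Fintype.card G : ℝ) ^ (((Fintype.card (Fin k × Fin (Fintype.card T)) : ℕ) : ℝ) * (1 - δ)) =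
        (((Fintype.card G : ℝ) ^ (1 - δ)) ^ Fintype.card T) ^ k := by
      rw [hkT, show (((k * Fintype.card T : ℕ) : ℝ)) * (1 - δ) = (1 - δ) * ((Fintype.card T * k : ℕ) : ℝ) by
        push_cast; ring, Real.rpow_mul_natCast hGpos.le, pow_mul]
    calc ((Fintype.card ι' : ℝ)) ^ k ≤ _ := h1'
      _ ≤ _ := h2
      _ = c * (((k : ℝ)) + 1) ^ 0 * ((((Fintype.card G : ℝ) ^ (1 - δ)) ^ Fintype.card T) ^ k) := by
          rw [h3, pow_zero, mul_one]
  have h4 : ((Fintype.card G : ℝ) ^ (1 - δ)) ^ Fintype.card T =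
      (((Fintype.card G : ℝ) ^ (1 - δ)) ^ (3 * N)) ^ N' := by
    rw [hcardT, mul_comm N' (3 * N), pow_mul]
  calc (Fintype.card ι' : ℝ) ≤ _ := key
    _ = (((Fintype.card G : ℝ) ^ (1 - δ)) ^ (3 * N)) ^ N' := h4
    _ ≤ 3 * (((Fintype.card G : ℝ) ^ (1 - δ)) ^ (3 * N)) ^ N' := by
        have : 0 ≤ (((Fintype.card G : ℝ) ^ (1 - δ)) ^ (3 * N)) ^ N' := by positivity
        linarith

end Matchings

/-! ## Inequality (2.2) at `w = 2 + 2δ` -/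

section Ineq22

/-- **BCCGU 2017, Cor. 2.11 with a constant**: `slice-rank_K D_{G^M} ≤ c|G|^{M(1-δ)}` for all
`M ≥ 1` (`δ > 0`, `c` arbitrary) forces CKSU's inequality (2.2) at `w = 2 + 2δ` for every STPP
family in `G`. [cite: BlasiakChurchCohnGrochowUmans2017, Cor. 2.11, Thm. 2.8 and Thm. 2.9] -/
theorem stpp_ineq_of_sliceRank_pow_le_const {G : Type} [Group G] [Fintype G] [DecidableEq G]
    (K : Type) [Field K] {δ c : ℝ} (hδ : 0 < δ)
    (hsr : ∀ M : ℕ, 1 ≤ M →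
      (sliceRank (mulGroupTensor K (Fin M → G)) : ℝ) ≤
        c * (Fintype.card G : ℝ) ^ ((M : ℝ) * (1 - δ)))
    {ι₀ : Type} [Fintype ι₀] [DecidableEq ι₀] {A B C : ι₀ → Finset G}
    (hS : SimultaneousTPP A B C) :
    ∑ i, (((A i).card * (B i).card * (C i).card : ℕ) : ℝ) ^ ((2 + 2 * δ) / 3) ≤
      charDegreePowSum G (2 + 2 * δ) := by
  have hGpos : (0 : ℝ) < Fintype.card G := by exact_mod_cast Fintype.card_pos
  have hY : 0 < (Fintype.card G : ℝ) ^ (1 - δ) := Real.rpow_pos_of_pos hGpos _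
  have hsum := SimultaneousTPP.sum_rpow_le_of_matching_bound hY
    (fun N N' ι' _ s t u h => card_le_of_sliceRank_pow_le_const hsr N N' ι' s t u h) hS
  have h := sum_rpow_le_charDegreePowSum_of_sum_rpow_le hδ hS hsum
  convert h using 2

/-- The single-triple case: a TPP triple `(S, T, U)` of `G` has
`(|S||T||U|)^{(2+2δ)/3} ≤ Σ_χ χ(1)^{2+2δ}` — a `(2+2δ)`-certificate exclusion.
[cite: BlasiakChurchCohnGrochowUmans2017, Cor. 2.11] -/
theorem tpp_certificate_of_sliceRank_pow_le_const {G : Type} [Group G] [Fintype G] [DecidableEq G]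
    (K : Type) [Field K] {δ c : ℝ} (hδ : 0 < δ)
    (hsr : ∀ M : ℕ, 1 ≤ M →
      (sliceRank (mulGroupTensor K (Fin M → G)) : ℝ) ≤
        c * (Fintype.card G : ℝ) ^ ((M : ℝ) * (1 - δ)))
    (S T U : Finset G) (hT : TripleProductProperty S T U) :
    ((S.card * T.card * U.card : ℕ) : ℝ) ^ ((2 + 2 * δ) / 3) ≤ charDegreePowSum G (2 + 2 * δ) := by
  classical
  have hS : SimultaneousTPP (fun _ : Fin 1 => S) (fun _ => T) (fun _ => U) :=
    ⟨fun _ => hT, fun a b c _ _ _ _ _ _ _ _ _ _ _ _ _ => ⟨Subsingleton.elim _ _, Subsingleton.elim _ _⟩⟩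
  have := stpp_ineq_of_sliceRank_pow_le_const K hδ hsr hS
  simpa using this

end Ineq22

/-! ## The door consequence -/

section Door

/-- **A uniform slice-rank saving on the powers of the hosts closes the door.**  Let `(Gᵢ)` be a
family of finite groups and `δ > 0`, `c` constants such that, over some field `Kᵢ` for each `i`,
`slice-rank_{Kᵢ} D_{Gᵢ^M} ≤ c |Gᵢ|^{M(1-δ)}` for all `M ≥ 1`.  Then `(Gᵢ)` cannot satisfy the
hypotheses of Cohn–Umans 2003, Cor. 4.3 (TPP triples of sizes `nᵢ, mᵢ, pᵢ` with `α → 2` at the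
Cor. 4.3 rate against the character-degree bound `dᵢ`): such a family would eventually beat every
`(2+ε)`-certificate (`tppFamily_false_of_noCertificate`), against
`tpp_certificate_of_sliceRank_pow_le_const` at `ε = 2δ`.  For each prime `p`, products of the groups
`SL₂(pⁿ)` (any number of factors, any exponents `n`) satisfy the hypothesis over `𝔽_p` by the
seat's Loewy-filtration bound (markdown Theorem C(p), `paper/sl2-defining-char-note.md`), which is the
rank-one, fixed-characteristic case of BCGPU 2023, §5.
[cite: BlasiakChurchCohnGrochowUmans2017, Cor. 2.11] [cite: CohnUmans2003, Cor. 4.3]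
[cite: BlasiakCohnGrochowPrattUmans2023, §5] -/
theorem no_tppFamily_of_sliceRankSaving (G : ℕ → Type) [∀ i, Group (G i)] [∀ i, Fintype (G i)]
    [∀ i, DecidableEq (G i)] (K : ℕ → Type) [∀ i, Field (K i)] {δ c : ℝ} (hδ : 0 < δ)
    (hsr : ∀ i, ∀ M : ℕ, 1 ≤ M →
      (sliceRank (mulGroupTensor (K i) (Fin M → G i)) : ℝ) ≤
        c * (Fintype.card (G i) : ℝ) ^ ((M : ℝ) * (1 - δ)))
    (n m p d : ℕ → ℕ)
    (h : ∀ i, RealizesTPP (G i) (n i) (m i) (p i)) (hd : ∀ i, maxCharDegree (G i) ≤ d i)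
    (hd2 : ∀ i, 2 ≤ d i) (hlt : ∀ i, d i ^ 3 < n i * m i * p i)
    (hα : Tendsto (fun i => 3 * Real.log (Nat.card (G i)) / Real.log ((n i * m i * p i : ℕ) : ℝ))
      atTop (𝓝 2))
    (ho : Tendsto (fun i => (3 * Real.log (Nat.card (G i)) / Real.log ((n i * m i * p i : ℕ) : ℝ) - 2) /
        (Real.log (Nat.card (G i)) / Real.log (d i) - 2)) atTop (𝓝 0)) :
    False :=
  tppFamily_false_of_noCertificate G n m p d h hd hd2 hlt hα ho (by positivity : (0 : ℝ) < 2 * δ)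
    fun i S T U hTPP => tpp_certificate_of_sliceRank_pow_le_const (K i) hδ (hsr i) S T U hTPP

end Door

end Summit.MatrixMultiplication.MatrixMultiplication.Theorems

end
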